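import Summits.QuantumFields.BalabanUV.Beta.GAN24.WardResidualSRecursion
import Summits.QuantumFields.BalabanUV.Beta.WardLocusResidualWall

/-!
# `BalabanUV.Beta.GAN24.WardResidualSRecursionAll` — binder row G-an2-4 / (CONV-C), CT-W route of record «WC-TL», located crux (Q-R):
# **THE WARD-LOCUS RESIDUAL TOWER IN S-STEP FORM, ALL LEVELS** — the D1 swarm's all-levels Ward kernel law of the W-literal `WrecAt`
# (`WardLocusRecursiveLetters.exists_kernelLaws_of_letters`, leaf-06) RE-RUN with the residual EXHIBITED as `vertexOfK G_j Lc (Φ j y) + Ψ j y` where the table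
# family `Φ` obeys the S-RECURSION of `SpineRooted.SpureRecAt_succ` (pin `cE = Lc^{d+1}`) with a BLOCK-SUMMED PASSIVE LABEL and explicit first-order sources, and `Ψ`
# is level-`j` first-order data only (road-P2 chair `b2b-balaban-gan24-p2`, gen 37; part 2 of INTENT journal 2026-08-22T03:12Z; p2's first refusal under
# RULING R-gan24p1-g24-1 (iii) and R-gan24p1-g24-2 (i)).

NOT IN PRINT; OUR BOOKKEEPING ([folklore] composition: parts A∕B∕C of the D1 swarm and `WardLocusResidualWall` BY NAME, hypotheses VERBATIM = those of
`exists_kernelLaws_of_letters` MINUS the row parities, which the S-step form does not need).  HONEST FRAMING (cell contract, verbatim): «discharging `BetaPertH` makes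
Bałaban's UV stability UNCONDITIONAL — a real constructive-QFT result; it is NOT the continuum limit and NOT the Clay problem.»  HONEST DEPENDENCY (verbatim): «continuum YM on
T⁴ ⇐ BetaPertH ∧ nine spine estimates (0/9 proved); BetaPertH ⇐ (D1) ∧ (D4) ∧ CAP+tail; G-an2-4 gates asym, D1 and NE2/3/4.»  No cited fact, no `def`, no `def … : Prop`,
0 sorry; instantiates NO binder of the β-function wall.

* §1 `tableLaw_T2RecAt_succ_sstep''` — the second-slot twin of `WardResidualSRecursion.tableLaw_T2RecAt_succ_sstep` (part A §3 `''` with the remainder in S-step form).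
* §2 **`exists_kernelLaws_vertexForm`** (generic `d`, in-block root, hW Ward pin, `cE₂ = Lc^{2(d+1)}`): from the letters (border both slots ∀ j, mixed ∀ j, Wilson at 0) with
  per-level classes, THERE ARE `Φ Ψ : ℕ → …` with: (Ψ) `Ψ j y ν y′ = vertexOfM G_j Lc (RM j y) ν y′ + ½ • (dM (conjV G_j (X y)) Lc S_j M_j ν y′ − cH_j • gauge_j y ν y′)`
  EXPLICIT; (Φ₀) `Φ 0 = ½ • ((RW + RB 0) + (RW″ + RB″ 0))`; **(Φ-STEP) `Φ (j+1) Y κ′u′ = Σ_{v∈box} (Lc^{d+1}·wE (j+1)) • e3OfK Lc G_j (Φ j (Lc•Y+v)) κ′u′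
  + (−(Lc^{d+1}·wE (j+1))) • Σ_v mmRead Lc (G_j ∘ Ψ j (Lc•Y+v) κ′u′ ∘ G_j) + ½ • (RB (j+1) + RB″ (j+1)) Y κ′u′`** — THE S-STEP with block-summed passive label, sources
  explicit; per-level classes of `Φ j` and of the residual; and (LAW) `∀ j, divW (WrecAt j) y ν y′ = conjV (dM G_j Lc S_j M_j ν y′) (X y) + (vertexOfK G_j Lc (Φ j y) ν y′ + Ψ j y ν y′)`.
  So the object of (Q-R) is ONE first-order-type table tower `Φ` running the S-step: (Q-R) ⟺ (Q-Φ) «ONE `(C, δ)` for all `j` (in units) in the fourth conjunct» — S-slot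
  technology (one-step row for the block-summed S-step on block-localised tables + the first-order charge pin if the rate is not < 1; RULING R-gan24p1-g24-2 (i)).
Asserts NO bound uniform in `j`; discharges NOTHING of (Q-R) ∕ (Q-Φ) ∕ (C) ∕ «T2Shape» ∕ «T2Drift» ∕ (hW, hWall); NEVER «G-an2-4 closed» as (CONV-C); NOT D1, NOT BetaPertH,
NOT continuum, NOT Clay.  Unit `b2b-balaban-gan24-p2` (gen 37), 2026-08-22; no existing file touched.
-/

noncomputable section

open Finset
open scoped BigOperators
open Literature.MathematicalPhysics.QuantumFieldTheory
open Literature.MathematicalPhysics.QuantumFieldTheory.Balaban1983to89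
open Literature.MathematicalPhysics.QuantumFieldTheory.Balaban1983to89.Beta
open ExpKernelCalculus (MKer Decays VertexFamily comp)
open KernelWard (Bdd divV divW bdd_of_biLoc)
open AffineAveraging (Site box toSite)
open OneStepResolventKernel (Fib wsum LocStencil)
open OneStepKernelFamily (KInvStep colH vertexOfK)
open InterLevelTransport (cwsum)
open BalabanStepJetsSucc (mmRead wE wVH)
open BalabanStepJets (locStencil_mono)
open SecondOrderResponse (colM vertexOfM dM LocStencilFM)
open BalabanCompositeJets (LocStencil₂)
open BalabanStepW2 (M2Of wV4 wB2)
open StepJetData (wilsonA locStencil_add locStencil_smul)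
open WilsonBiStencil (wilsonW₂)
open AveragingHessianKernelsRooted (vhSAt)
open Summit.QuantumFields.BalabanUV.Beta.TameKernelCalculus
open Summit.QuantumFields.BalabanUV.Beta.ChartConjugation (conjV)
open Summit.QuantumFields.BalabanUV.Beta.BorderedHessian (diagK stepScale)
open Summit.QuantumFields.BalabanUV.Beta.AveragingWardRootedStencils (legInd)
open Summit.QuantumFields.BalabanUV.Beta.AxialDressingRooted (coDressKBmAt decays_coDressKBmAt_KInvStep)
open Summit.QuantumFields.BalabanUV.Beta.SpineRooted (SpureRecAt M1At T2RecAt WrecAt e3OfK)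
open Summit.QuantumFields.BalabanUV.Beta.KernelWardRelative (gaugeWt)
open Summit.QuantumFields.BalabanUV.Beta.WardLocusQuarticTable (tableLaw_T2RecAt_succ'' lock_succ_of_pin)
open Summit.QuantumFields.BalabanUV.Beta.WardLocusRecursiveAll (divW_WrecAt_zero_of_letters divW_WrecAt_succ_of_kernelLaw)
open Summit.QuantumFields.BalabanUV.Beta.WardLocusResidualWall (exists_vertexFamily_residual_wall exists_locStencil_transport_wall exists_bound_transport_wall)
open Summit.QuantumFields.BalabanUV.Beta.GAN24.WardResidualSRecursion (transport_vertexForm residual_eq_vertexForm₀ lock_cancel tableLaw_T2RecAt_succ_sstep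
  divW_WrecAt_succ_vertexForm)

namespace Summit.QuantumFields.BalabanUV.Beta.GAN24.WardResidualSRecursionAll

variable {d Lc : ℕ} [NeZero Lc]

/-! ## §1 The second-slot table law of `T2RecAt (j+1)` with its remainder in S-step form -/

/-- NOT IN PRINT; OUR BOOKKEEPING ([folklore] rewriting of leaf-06's part A §3 `WardLocusQuarticTable.tableLaw_T2RecAt_succ''`, hypotheses VERBATIM plus the VERTEX FORM of
the level-`j` residual).  **THE LEVEL-(j+1) TABLE LAW OF `T2RecAt (j+1)`, SECOND SLOT (`hS₂''` shape), WITH ITS REMAINDER IN S-STEP FORM.**  At the hW Ward pin, in-block root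
`ρ = toSite r`, `G_j = coDressKBmAt ρ Lc (KInvStep Lc j)`: if the level-`j` kernel-law residual has the vertex form `𝒩 y ν y′ = vertexOfK G_j Lc (Φ y) ν y′ + Ψ y ν y′`
(bounded `Φ`, `Ψ`), then the `hS₂''` law of `T2RecAt (j+1)` against `SpureRecAt (j+1)` holds with the remainder
`Σ_{v∈box} (Lc^{d+1}·wE (j+1)) • e3OfK Lc G_j (Φ (Lc•Y+v)) κ′u′ + (−(Lc^{d+1}·wE (j+1)) • Σ_v mmRead Lc (G_j ∘ Ψ (Lc•Y+v) κ′u′ ∘ G_j) + RB″ Y κ u)` —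
the first summand is TOKEN FOR TOKEN the map of `SpineRooted.SpureRecAt_succ` (the S-STEP at `cE = Lc^{d+1}`) applied to `Φ (Lc•Y+v)` and summed over the
fine blocks of the coarse label `Y`. -/
theorem tableLaw_T2RecAt_succ_sstep'' (hLc : 1 ≤ Lc) {r : Fin (d + 1) → ℕ} (hr : r ∈ box (d + 1) Lc) (cΛ cE₂ cB : ℝ)
    (T : Fin 4 → Fin 4 → Fin 4 → Fin 4 → ℝ)
    {vh₂S : Fin (d + 1) → (Fin (d + 1) → ℤ) → Fin (d + 1) → (Fin (d + 1) → ℤ) → MKer (d + 1) (Fib d)}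
    (hB : ∃ C δ : ℝ, 0 < δ ∧ LocStencil₂ vh₂S C δ)
    {mixFF : Fin (d + 1) → (Fin (d + 1) → ℤ) → Fin (d + 1) → (Fin (d + 1) → ℤ) → MKer (d + 1) (Fib d)}
    (hmix : ∃ C δ : ℝ, 0 < δ ∧ LocStencilFM Lc mixFF C δ) (j : ℕ)
    {𝒩 : (Fin (d + 1) → ℤ) → Fin (d + 1) → (Fin (d + 1) → ℤ) → MKer (d + 1) (Fib d)} (h𝒩 : ∀ y ν y', Loc (𝒩 y ν y'))
    (hWd : ∀ (y : Fin (d + 1) → ℤ) (ν : Fin (d + 1)) (y' : Fin (d + 1) → ℤ),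
      divW (WrecAt d Lc (toSite r) ((Lc : ℝ) ^ (d + 1)) (-((Lc : ℝ) ^ (d + 1) * (1 / 2) * (Lc : ℝ) ^ (d + 1))) cΛ cE₂ cB T vh₂S mixFF j) y ν y' =
        conjV (dM (coDressKBmAt (toSite r) Lc (KInvStep (d := d) Lc j)) Lc
            (SpureRecAt d Lc (toSite r) ((Lc : ℝ) ^ (d + 1)) (-((Lc : ℝ) ^ (d + 1) * (1 / 2) * (Lc : ℝ) ^ (d + 1))) cΛ j)
            (M1At d Lc (toSite r) cΛ j) ν y')
          (diagK (((1 : ℝ) / 2) • ∑ v ∈ box (d + 1) Lc, legInd (toSite r) ((Lc : ℤ) • y + toSite v))) + 𝒩 y ν y')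
    -- NEW w.r.t. part A: the VERTEX FORM of the level-`j` residual (bounded table `Φ`, bounded first-order part `Ψ`)
    {Φ : (Fin (d + 1) → ℤ) → Fin (d + 1) → (Fin (d + 1) → ℤ) → MKer (d + 1) (Fib d)}
    {Ψ : (Fin (d + 1) → ℤ) → Fin (d + 1) → (Fin (d + 1) → ℤ) → MKer (d + 1) (Fib d)} {BΦ BΨ : ℝ}
    (hΦ : ∀ y κ u x z a b, |Φ y κ u x z a b| ≤ BΦ) (hΨ : ∀ y κ u x z a b, |Ψ y κ u x z a b| ≤ BΨ)
    (h𝒩v : ∀ y ν y', 𝒩 y ν y' = vertexOfK (coDressKBmAt (toSite r) Lc (KInvStep (d := d) Lc j)) Lc (Φ y) ν y' + Ψ y ν y')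
    {cH' : ℝ} (hlock : cH' * (cE₂ * wV4 d Lc (j + 1)) * ((1 : ℝ) / 2) = ((Lc : ℝ) ^ (d + 1) * wE d Lc (j + 1)) * ((1 : ℝ) / 2))
    {RB'' : (Fin (d + 1) → ℤ) → Fin (d + 1) → (Fin (d + 1) → ℤ) → MKer (d + 1) (Fib d)}
    (hBord'' : ∀ (Y : Fin (d + 1) → ℤ) (κ : Fin (d + 1)) (u : Fin (d + 1) → ℤ),
      cH' • ∑ v ∈ box (d + 1) Lc, divV (fun κ' u' => (cB * wB2 d Lc (j + 1)) • vh₂S κ u κ' u') ((Lc : ℤ) • Y + toSite v) =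
        comp ((-((Lc : ℝ) ^ (d + 1) * (1 / 2) * (Lc : ℝ) ^ (d + 1)) * wVH d Lc (j + 1)) • vhSAt (toSite r) d Lc rfl κ u)
            (diagK (((1 : ℝ) / 2) • ∑ v ∈ box (d + 1) Lc, legInd (toSite r) ((Lc : ℤ) • Y + toSite v)))
          - comp (diagK (((1 : ℝ) / 2) • ∑ v ∈ box (d + 1) Lc, legInd (toSite r) ((Lc : ℤ) • Y + toSite v)))
            ((-((Lc : ℝ) ^ (d + 1) * (1 / 2) * (Lc : ℝ) ^ (d + 1)) * wVH d Lc (j + 1)) • vhSAt (toSite r) d Lc rfl κ u)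
          + RB'' Y κ u)
    (Y : Fin (d + 1) → ℤ) (κ : Fin (d + 1)) (u : Fin (d + 1) → ℤ) :
    cH' • ∑ v ∈ box (d + 1) Lc, divV
        (T2RecAt d Lc (toSite r) ((Lc : ℝ) ^ (d + 1)) (-((Lc : ℝ) ^ (d + 1) * (1 / 2) * (Lc : ℝ) ^ (d + 1))) cΛ cE₂ cB T vh₂S mixFF (j + 1) κ u)
        ((Lc : ℤ) • Y + toSite v) =
      comp (SpureRecAt d Lc (toSite r) ((Lc : ℝ) ^ (d + 1)) (-((Lc : ℝ) ^ (d + 1) * (1 / 2) * (Lc : ℝ) ^ (d + 1))) cΛ (j + 1) κ u)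
          (diagK (((1 : ℝ) / 2) • ∑ v ∈ box (d + 1) Lc, legInd (toSite r) ((Lc : ℤ) • Y + toSite v)))
        - comp (diagK (((1 : ℝ) / 2) • ∑ v ∈ box (d + 1) Lc, legInd (toSite r) ((Lc : ℤ) • Y + toSite v)))
          (SpureRecAt d Lc (toSite r) ((Lc : ℝ) ^ (d + 1)) (-((Lc : ℝ) ^ (d + 1) * (1 / 2) * (Lc : ℝ) ^ (d + 1))) cΛ (j + 1) κ u)
        + (∑ v ∈ box (d + 1) Lc, ((Lc : ℝ) ^ (d + 1) * wE d Lc (j + 1)) •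
              e3OfK Lc (coDressKBmAt (toSite r) Lc (KInvStep (d := d) Lc j)) (Φ ((Lc : ℤ) • Y + toSite v)) κ u
            + ((-((Lc : ℝ) ^ (d + 1) * wE d Lc (j + 1))) • ∑ v ∈ box (d + 1) Lc,
                mmRead Lc (comp (comp (coDressKBmAt (toSite r) Lc (KInvStep (d := d) Lc j)) (Ψ ((Lc : ℤ) • Y + toSite v) κ u))
                  (coDressKBmAt (toSite r) Lc (KInvStep (d := d) Lc j)))
              + RB'' Y κ u)) := by
  obtain ⟨δK, CK, hδK, hCK, hKd⟩ := decays_coDressKBmAt_KInvStep (d := d) hr j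
  rw [tableLaw_T2RecAt_succ'' hLc hr cΛ cE₂ cB T hB hmix j h𝒩 hWd hlock hBord'' Y κ u,
    transport_vertexForm hKd hδK Lc hΦ hΨ h𝒩v _ _ Y κ u, neg_neg, lock_cancel hlock, add_assoc]



/-! ## §2 All levels: the residual tower in vertex form, the table tower running the S-step -/

/-- NOT IN PRINT; OUR BOOKKEEPING ([folklore] composition BY NAME; hypotheses = those of leaf-06's `WardLocusRecursiveLetters.exists_kernelLaws_of_letters` minus the row
parities).  **THE ALL-LEVELS WARD KERNEL LAW OF `WrecAt` WITH THE RESIDUAL IN VERTEX FORM; THE TABLE TOWER RUNS THE S-STEP.**  See the module docstring: `∃ Φ Ψ`, (Ψ)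
explicit first-order data, (Φ₀), (Φ-STEP) = the S-step of `SpureRecAt_succ` with block-summed passive label + explicit sources, per-level classes, (LAW) ∀ j.  Proof: ONE
induction on the level carrying (class of `Φ j`) ∧ (class of the vertex-form residual) ∧ (law); level 0 = part C §1 + `residual_eq_vertexForm₀`; step = part C §2 in both
shapes (`divW_WrecAt_succ_of_kernelLaw`, `divW_WrecAt_succ_vertexForm` ⇒ the two residuals agree by `add_left_cancel`), `transport_vertexForm` + the lock for `Φ (j+1) =
½ • (R_{j+1} + R″_{j+1})`, classes by `WardLocusResidualWall`. -/
theorem exists_kernelLaws_vertexForm (hLc : 1 ≤ Lc) {r : Fin (d + 1) → ℕ} (hr : r ∈ box (d + 1) Lc) (cΛ cB : ℝ) {cE₂ : ℝ}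
    (hcE₂ : cE₂ = (Lc : ℝ) ^ (2 * (d + 1))) (T : Fin 4 → Fin 4 → Fin 4 → Fin 4 → ℝ)
    {vh₂S : Fin (d + 1) → (Fin (d + 1) → ℤ) → Fin (d + 1) → (Fin (d + 1) → ℤ) → MKer (d + 1) (Fib d)}
    (hB : ∃ C δ : ℝ, 0 < δ ∧ LocStencil₂ vh₂S C δ)
    {mixFF : Fin (d + 1) → (Fin (d + 1) → ℤ) → Fin (d + 1) → (Fin (d + 1) → ℤ) → MKer (d + 1) (Fib d)}
    (hmix : ∃ C δ : ℝ, 0 < δ ∧ LocStencilFM Lc mixFF C δ)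
    -- the LETTERS' remainders (an1's border law both slots ∀ j ≥ 0, an1's mixed law ∀ j, the level-0 Wilson law), their classes (one rate per level; NO row parities needed here)
    {RW RW'' : (Fin (d + 1) → ℤ) → Fin (d + 1) → (Fin (d + 1) → ℤ) → MKer (d + 1) (Fib d)} {RB RB'' : ℕ → (Fin (d + 1) → ℤ) → Fin (d + 1) → (Fin (d + 1) → ℤ) → MKer (d + 1) (Fib d)} {RM : ℕ → (Fin (d + 1) → ℤ) → Fin (d + 1) → (Fin (d + 1) → ℤ) → MKer (d + 1) (Fib d)}
    (hcls0 : ∃ C δ : ℝ, 0 < δ ∧ (∀ Y, LocStencil (RW Y) C δ) ∧ (∀ Y, LocStencil (RW'' Y) C δ) ∧ (∀ Y, LocStencil (RB 0 Y) C δ) ∧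
      (∀ Y, LocStencil (RB'' 0 Y) C δ) ∧ (∀ y, VertexFamily (RM 0 y) Lc C δ))
    (hclsS : ∀ j : ℕ, ∃ C δ : ℝ, 0 < δ ∧ (∀ Y, LocStencil (RB (j + 1) Y) C δ) ∧ (∀ Y, LocStencil (RB'' (j + 1) Y) C δ) ∧
      (∀ y, VertexFamily (RM (j + 1) y) Lc C δ))
    (hWil : ∀ (Y : Fin (d + 1) → ℤ) (κ' : Fin (d + 1)) (u' : Fin (d + 1) → ℤ),
      (stepScale d Lc 0 * (Lc : ℝ) ^ (d + 1))⁻¹ • ∑ v ∈ box (d + 1) Lc, divV (fun κ u => cE₂ • wilsonW₂ d T κ u κ' u') ((Lc : ℤ) • Y + toSite v) =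
        comp (((Lc : ℝ) ^ (d + 1)) • wilsonA d κ' u') (diagK (((1 : ℝ) / 2) • ∑ v ∈ box (d + 1) Lc, legInd (toSite r) ((Lc : ℤ) • Y + toSite v)))
          - comp (diagK (((1 : ℝ) / 2) • ∑ v ∈ box (d + 1) Lc, legInd (toSite r) ((Lc : ℤ) • Y + toSite v))) (((Lc : ℝ) ^ (d + 1)) • wilsonA d κ' u')
          + RW Y κ' u')
    (hWil'' : ∀ (Y : Fin (d + 1) → ℤ) (κ : Fin (d + 1)) (u : Fin (d + 1) → ℤ),
      (stepScale d Lc 0 * (Lc : ℝ) ^ (d + 1))⁻¹ • ∑ v ∈ box (d + 1) Lc, divV (fun κ' u' => cE₂ • wilsonW₂ d T κ u κ' u') ((Lc : ℤ) • Y + toSite v) =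
        comp (((Lc : ℝ) ^ (d + 1)) • wilsonA d κ u) (diagK (((1 : ℝ) / 2) • ∑ v ∈ box (d + 1) Lc, legInd (toSite r) ((Lc : ℤ) • Y + toSite v)))
          - comp (diagK (((1 : ℝ) / 2) • ∑ v ∈ box (d + 1) Lc, legInd (toSite r) ((Lc : ℤ) • Y + toSite v))) (((Lc : ℝ) ^ (d + 1)) • wilsonA d κ u)
          + RW'' Y κ u)
    (hBord0 : ∀ (Y : Fin (d + 1) → ℤ) (κ' : Fin (d + 1)) (u' : Fin (d + 1) → ℤ),
      (stepScale d Lc 0 * (Lc : ℝ) ^ (d + 1))⁻¹ • ∑ v ∈ box (d + 1) Lc, divV (fun κ u => cB • vh₂S κ u κ' u') ((Lc : ℤ) • Y + toSite v) =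
        comp ((-((Lc : ℝ) ^ (d + 1) * (1 / 2) * (Lc : ℝ) ^ (d + 1))) • vhSAt (toSite r) d Lc rfl κ' u') (diagK (((1 : ℝ) / 2) • ∑ v ∈ box (d + 1) Lc, legInd (toSite r) ((Lc : ℤ) • Y + toSite v)))
          - comp (diagK (((1 : ℝ) / 2) • ∑ v ∈ box (d + 1) Lc, legInd (toSite r) ((Lc : ℤ) • Y + toSite v))) ((-((Lc : ℝ) ^ (d + 1) * (1 / 2) * (Lc : ℝ) ^ (d + 1))) • vhSAt (toSite r) d Lc rfl κ' u')
          + RB 0 Y κ' u')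
    (hBord0'' : ∀ (Y : Fin (d + 1) → ℤ) (κ : Fin (d + 1)) (u : Fin (d + 1) → ℤ),
      (stepScale d Lc 0 * (Lc : ℝ) ^ (d + 1))⁻¹ • ∑ v ∈ box (d + 1) Lc, divV (fun κ' u' => cB • vh₂S κ u κ' u') ((Lc : ℤ) • Y + toSite v) =
        comp ((-((Lc : ℝ) ^ (d + 1) * (1 / 2) * (Lc : ℝ) ^ (d + 1))) • vhSAt (toSite r) d Lc rfl κ u) (diagK (((1 : ℝ) / 2) • ∑ v ∈ box (d + 1) Lc, legInd (toSite r) ((Lc : ℤ) • Y + toSite v)))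
          - comp (diagK (((1 : ℝ) / 2) • ∑ v ∈ box (d + 1) Lc, legInd (toSite r) ((Lc : ℤ) • Y + toSite v))) ((-((Lc : ℝ) ^ (d + 1) * (1 / 2) * (Lc : ℝ) ^ (d + 1))) • vhSAt (toSite r) d Lc rfl κ u)
          + RB'' 0 Y κ u)
    (hBordS : ∀ (j : ℕ) (Y : Fin (d + 1) → ℤ) (κ' : Fin (d + 1)) (u' : Fin (d + 1) → ℤ),
      (stepScale d Lc (j + 1) * (Lc : ℝ) ^ (d + 1))⁻¹ •
          ∑ v ∈ box (d + 1) Lc, divV (fun κ u => (cB * wB2 d Lc (j + 1)) • vh₂S κ u κ' u') ((Lc : ℤ) • Y + toSite v) =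
        comp ((-((Lc : ℝ) ^ (d + 1) * (1 / 2) * (Lc : ℝ) ^ (d + 1)) * wVH d Lc (j + 1)) • vhSAt (toSite r) d Lc rfl κ' u') (diagK (((1 : ℝ) / 2) • ∑ v ∈ box (d + 1) Lc, legInd (toSite r) ((Lc : ℤ) • Y + toSite v)))
          - comp (diagK (((1 : ℝ) / 2) • ∑ v ∈ box (d + 1) Lc, legInd (toSite r) ((Lc : ℤ) • Y + toSite v))) ((-((Lc : ℝ) ^ (d + 1) * (1 / 2) * (Lc : ℝ) ^ (d + 1)) * wVH d Lc (j + 1)) • vhSAt (toSite r) d Lc rfl κ' u')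
          + RB (j + 1) Y κ' u')
    (hBordS'' : ∀ (j : ℕ) (Y : Fin (d + 1) → ℤ) (κ : Fin (d + 1)) (u : Fin (d + 1) → ℤ),
      (stepScale d Lc (j + 1) * (Lc : ℝ) ^ (d + 1))⁻¹ •
          ∑ v ∈ box (d + 1) Lc, divV (fun κ' u' => (cB * wB2 d Lc (j + 1)) • vh₂S κ u κ' u') ((Lc : ℤ) • Y + toSite v) =
        comp ((-((Lc : ℝ) ^ (d + 1) * (1 / 2) * (Lc : ℝ) ^ (d + 1)) * wVH d Lc (j + 1)) • vhSAt (toSite r) d Lc rfl κ u) (diagK (((1 : ℝ) / 2) • ∑ v ∈ box (d + 1) Lc, legInd (toSite r) ((Lc : ℤ) • Y + toSite v)))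
          - comp (diagK (((1 : ℝ) / 2) • ∑ v ∈ box (d + 1) Lc, legInd (toSite r) ((Lc : ℤ) • Y + toSite v))) ((-((Lc : ℝ) ^ (d + 1) * (1 / 2) * (Lc : ℝ) ^ (d + 1)) * wVH d Lc (j + 1)) • vhSAt (toSite r) d Lc rfl κ u)
          + RB'' (j + 1) Y κ u)
    (hM₂ : ∀ (j : ℕ) (y : Fin (d + 1) → ℤ) (ρ' : Fin (d + 1)) (w : Fin (d + 1) → ℤ),
      (stepScale d Lc j * (Lc : ℝ) ^ (d + 1))⁻¹ • ∑ v ∈ box (d + 1) Lc, divV (fun κ u => M2Of d Lc mixFF j κ u ρ' w) ((Lc : ℤ) • y + toSite v) =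
        comp (M1At d Lc (toSite r) cΛ j ρ' w) (diagK (((1 : ℝ) / 2) • ∑ v ∈ box (d + 1) Lc, legInd (toSite r) ((Lc : ℤ) • y + toSite v)))
          - comp (diagK (((1 : ℝ) / 2) • ∑ v ∈ box (d + 1) Lc, legInd (toSite r) ((Lc : ℤ) • y + toSite v))) (M1At d Lc (toSite r) cΛ j ρ' w)
          + RM j y ρ' w) :
    ∃ Φ Ψ : ℕ → (Fin (d + 1) → ℤ) → Fin (d + 1) → (Fin (d + 1) → ℤ) → MKer (d + 1) (Fib d),
      -- (Ψ) the vertex-free part: level-`j` FIRST-ORDER data and letters only (multiplier vertex of `RM j`, rotated vertex, gauge read)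
      (∀ (j : ℕ) (y : Fin (d + 1) → ℤ) (ν : Fin (d + 1)) (y' : Fin (d + 1) → ℤ), Ψ j y ν y' =
        vertexOfM (coDressKBmAt (toSite r) Lc (KInvStep (d := d) Lc j)) Lc (RM j y) ν y'
        + (1 / 2 : ℝ) • (dM (conjV (coDressKBmAt (toSite r) Lc (KInvStep (d := d) Lc j))
                (diagK (((1 : ℝ) / 2) • ∑ v ∈ box (d + 1) Lc, legInd (toSite r) ((Lc : ℤ) • y + toSite v)))) Lc
              (SpureRecAt d Lc (toSite r) ((Lc : ℝ) ^ (d + 1)) (-((Lc : ℝ) ^ (d + 1) * (1 / 2) * (Lc : ℝ) ^ (d + 1))) cΛ j)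
              (M1At d Lc (toSite r) cΛ j) ν y'
          - (stepScale d Lc j * (Lc : ℝ) ^ (d + 1))⁻¹ • (∑ κ, wsum (fun u => ∑' x₂, ∑ κ₂,
              comp (coDressKBmAt (toSite r) Lc (KInvStep (d := d) Lc j))
                (dM (coDressKBmAt (toSite r) Lc (KInvStep (d := d) Lc j)) Lc
                  (SpureRecAt d Lc (toSite r) ((Lc : ℝ) ^ (d + 1)) (-((Lc : ℝ) ^ (d + 1) * (1 / 2) * (Lc : ℝ) ^ (d + 1))) cΛ j)
                  (M1At d Lc (toSite r) cΛ j) ν y') u x₂ (Sum.inl κ) (Sum.inl κ₂) * gaugeWt Lc y κ₂ x₂)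
              (SpureRecAt d Lc (toSite r) ((Lc : ℝ) ^ (d + 1)) (-((Lc : ℝ) ^ (d + 1) * (1 / 2) * (Lc : ℝ) ^ (d + 1))) cΛ j κ)
            + ∑ ρ', cwsum Lc (fun w => ∑' x₂, ∑ κ₂,
              comp (coDressKBmAt (toSite r) Lc (KInvStep (d := d) Lc j))
                (dM (coDressKBmAt (toSite r) Lc (KInvStep (d := d) Lc j)) Lc
                  (SpureRecAt d Lc (toSite r) ((Lc : ℝ) ^ (d + 1)) (-((Lc : ℝ) ^ (d + 1) * (1 / 2) * (Lc : ℝ) ^ (d + 1))) cΛ j)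
                  (M1At d Lc (toSite r) cΛ j) ν y') ((Lc : ℤ) • w) x₂ (Sum.inr ρ') (Sum.inl κ₂) * gaugeWt Lc y κ₂ x₂)
              (M1At d Lc (toSite r) cΛ j ρ')))) ∧
      -- (Φ₀) the level-0 table: half the sum of the four level-0 letter remainders
      (Φ 0 = fun y κ u => (1 / 2 : ℝ) • ((RW y κ u + RB 0 y κ u) + (RW'' y κ u + RB'' 0 y κ u))) ∧
      -- (Φ-STEP) THE S-RECURSION WITH BLOCK-SUMMED PASSIVE LABEL (the map of `SpineRooted.SpureRecAt_succ`, pin `cE = Lc^(d+1)`) + explicit sources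
      (∀ j : ℕ, Φ (j + 1) = fun Y κ' u' =>
        ∑ v ∈ box (d + 1) Lc, ((Lc : ℝ) ^ (d + 1) * wE d Lc (j + 1)) •
            e3OfK Lc (coDressKBmAt (toSite r) Lc (KInvStep (d := d) Lc j)) (Φ j ((Lc : ℤ) • Y + toSite v)) κ' u'
          + ((-((Lc : ℝ) ^ (d + 1) * wE d Lc (j + 1))) • ∑ v ∈ box (d + 1) Lc,
                mmRead Lc (comp (comp (coDressKBmAt (toSite r) Lc (KInvStep (d := d) Lc j)) (Ψ j ((Lc : ℤ) • Y + toSite v) κ' u'))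
                  (coDressKBmAt (toSite r) Lc (KInvStep (d := d) Lc j)))
            + (1 / 2 : ℝ) • (RB (j + 1) Y κ' u' + RB'' (j + 1) Y κ' u'))) ∧
      -- per-level classes (NO uniformity in `j` is asserted: that is (Q-Φ) ∕ (Q-R))
      (∀ j : ℕ, ∃ C δ : ℝ, 0 < δ ∧ ∀ y, LocStencil (Φ j y) C δ) ∧
      (∀ j : ℕ, ∃ C δ : ℝ, 0 < δ ∧ ∀ y, VertexFamily (fun ν y' => vertexOfK (coDressKBmAt (toSite r) Lc (KInvStep (d := d) Lc j)) Lc (Φ j y) ν y' + Ψ j y ν y') Lc C δ) ∧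
      -- THE WARD KERNEL LAW AT EVERY LEVEL WITH THE RESIDUAL IN VERTEX FORM
      (∀ (j : ℕ) (y : Fin (d + 1) → ℤ) (ν : Fin (d + 1)) (y' : Fin (d + 1) → ℤ),
        divW (WrecAt d Lc (toSite r) ((Lc : ℝ) ^ (d + 1)) (-((Lc : ℝ) ^ (d + 1) * (1 / 2) * (Lc : ℝ) ^ (d + 1))) cΛ cE₂ cB T vh₂S mixFF j) y ν y' =
          conjV (dM (coDressKBmAt (toSite r) Lc (KInvStep (d := d) Lc j)) Lc
            (SpureRecAt d Lc (toSite r) ((Lc : ℝ) ^ (d + 1)) (-((Lc : ℝ) ^ (d + 1) * (1 / 2) * (Lc : ℝ) ^ (d + 1))) cΛ j)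
            (M1At d Lc (toSite r) cΛ j) ν y')
          (diagK (((1 : ℝ) / 2) • ∑ v ∈ box (d + 1) Lc, legInd (toSite r) ((Lc : ℤ) • y + toSite v)))
        + (vertexOfK (coDressKBmAt (toSite r) Lc (KInvStep (d := d) Lc j)) Lc (Φ j y) ν y' + Ψ j y ν y')) := by
  -- the explicit vertex-free part and the table family by recursion on the level
  let Ψf : ℕ → (Fin (d + 1) → ℤ) → Fin (d + 1) → (Fin (d + 1) → ℤ) → MKer (d + 1) (Fib d) := fun j y ν y' =>
        vertexOfM (coDressKBmAt (toSite r) Lc (KInvStep (d := d) Lc j)) Lc (RM j y) ν y'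
        + (1 / 2 : ℝ) • (dM (conjV (coDressKBmAt (toSite r) Lc (KInvStep (d := d) Lc j))
                (diagK (((1 : ℝ) / 2) • ∑ v ∈ box (d + 1) Lc, legInd (toSite r) ((Lc : ℤ) • y + toSite v)))) Lc
              (SpureRecAt d Lc (toSite r) ((Lc : ℝ) ^ (d + 1)) (-((Lc : ℝ) ^ (d + 1) * (1 / 2) * (Lc : ℝ) ^ (d + 1))) cΛ j)
              (M1At d Lc (toSite r) cΛ j) ν y'
          - (stepScale d Lc j * (Lc : ℝ) ^ (d + 1))⁻¹ • (∑ κ, wsum (fun u => ∑' x₂, ∑ κ₂,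
              comp (coDressKBmAt (toSite r) Lc (KInvStep (d := d) Lc j))
                (dM (coDressKBmAt (toSite r) Lc (KInvStep (d := d) Lc j)) Lc
                  (SpureRecAt d Lc (toSite r) ((Lc : ℝ) ^ (d + 1)) (-((Lc : ℝ) ^ (d + 1) * (1 / 2) * (Lc : ℝ) ^ (d + 1))) cΛ j)
                  (M1At d Lc (toSite r) cΛ j) ν y') u x₂ (Sum.inl κ) (Sum.inl κ₂) * gaugeWt Lc y κ₂ x₂)
              (SpureRecAt d Lc (toSite r) ((Lc : ℝ) ^ (d + 1)) (-((Lc : ℝ) ^ (d + 1) * (1 / 2) * (Lc : ℝ) ^ (d + 1))) cΛ j κ)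
            + ∑ ρ', cwsum Lc (fun w => ∑' x₂, ∑ κ₂,
              comp (coDressKBmAt (toSite r) Lc (KInvStep (d := d) Lc j))
                (dM (coDressKBmAt (toSite r) Lc (KInvStep (d := d) Lc j)) Lc
                  (SpureRecAt d Lc (toSite r) ((Lc : ℝ) ^ (d + 1)) (-((Lc : ℝ) ^ (d + 1) * (1 / 2) * (Lc : ℝ) ^ (d + 1))) cΛ j)
                  (M1At d Lc (toSite r) cΛ j) ν y') ((Lc : ℤ) • w) x₂ (Sum.inr ρ') (Sum.inl κ₂) * gaugeWt Lc y κ₂ x₂)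
              (M1At d Lc (toSite r) cΛ j ρ')))
  let Φ0 : (Fin (d + 1) → ℤ) → Fin (d + 1) → (Fin (d + 1) → ℤ) → MKer (d + 1) (Fib d) := fun y κ u => (1 / 2 : ℝ) • ((RW y κ u + RB 0 y κ u) + (RW'' y κ u + RB'' 0 y κ u))
  let ΦS : ℕ → ((Fin (d + 1) → ℤ) → Fin (d + 1) → (Fin (d + 1) → ℤ) → MKer (d + 1) (Fib d)) → (Fin (d + 1) → ℤ) → Fin (d + 1) → (Fin (d + 1) → ℤ) → MKer (d + 1) (Fib d) := fun j Φj => fun Y κ' u' =>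
        ∑ v ∈ box (d + 1) Lc, ((Lc : ℝ) ^ (d + 1) * wE d Lc (j + 1)) •
            e3OfK Lc (coDressKBmAt (toSite r) Lc (KInvStep (d := d) Lc j)) (Φj ((Lc : ℤ) • Y + toSite v)) κ' u'
          + ((-((Lc : ℝ) ^ (d + 1) * wE d Lc (j + 1))) • ∑ v ∈ box (d + 1) Lc,
                mmRead Lc (comp (comp (coDressKBmAt (toSite r) Lc (KInvStep (d := d) Lc j)) (Ψf j ((Lc : ℤ) • Y + toSite v) κ' u'))
                  (coDressKBmAt (toSite r) Lc (KInvStep (d := d) Lc j)))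
            + (1 / 2 : ℝ) • (RB (j + 1) Y κ' u' + RB'' (j + 1) Y κ' u'))
  let Φ : ℕ → (Fin (d + 1) → ℤ) → Fin (d + 1) → (Fin (d + 1) → ℤ) → MKer (d + 1) (Fib d) := fun j => Nat.rec Φ0 ΦS j
  have hΦ0 : Φ 0 = Φ0 := rfl
  have hΦS : ∀ j, Φ (j + 1) = ΦS j (Φ j) := fun j => rfl
  -- ONE induction carrying (class of Φ j) ∧ (class of the vertex-form residual) ∧ (law)
  have key : ∀ j : ℕ,
      (∃ C δ : ℝ, 0 < δ ∧ ∀ y, LocStencil (Φ j y) C δ) ∧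
      (∃ C δ : ℝ, 0 < δ ∧ ∀ y, VertexFamily (fun ν y' => vertexOfK (coDressKBmAt (toSite r) Lc (KInvStep (d := d) Lc j)) Lc (Φ j y) ν y' + Ψf j y ν y') Lc C δ) ∧
      (∀ (y : Fin (d + 1) → ℤ) (ν : Fin (d + 1)) (y' : Fin (d + 1) → ℤ),
        divW (WrecAt d Lc (toSite r) ((Lc : ℝ) ^ (d + 1)) (-((Lc : ℝ) ^ (d + 1) * (1 / 2) * (Lc : ℝ) ^ (d + 1))) cΛ cE₂ cB T vh₂S mixFF j) y ν y' =
          conjV (dM (coDressKBmAt (toSite r) Lc (KInvStep (d := d) Lc j)) Lc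
            (SpureRecAt d Lc (toSite r) ((Lc : ℝ) ^ (d + 1)) (-((Lc : ℝ) ^ (d + 1) * (1 / 2) * (Lc : ℝ) ^ (d + 1))) cΛ j)
            (M1At d Lc (toSite r) cΛ j) ν y')
          (diagK (((1 : ℝ) / 2) • ∑ v ∈ box (d + 1) Lc, legInd (toSite r) ((Lc : ℤ) • y + toSite v)))
        + (vertexOfK (coDressKBmAt (toSite r) Lc (KInvStep (d := d) Lc j)) Lc (Φ j y) ν y' + Ψf j y ν y')) := by
    intro j
    induction j with
    | zero =>
      obtain ⟨C0, δ0, hδ0, hRWl, hRW''l, hRBl, hRB''l, hRMl⟩ := hcls0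
      have hK0 := decays_coDressKBmAt_KInvStep (d := d) hr 0
      have hRl : ∀ Y, LocStencil (fun κ u => RW Y κ u + RB 0 Y κ u) (C0 + C0) δ0 := fun Y => locStencil_add (hRWl Y) (hRBl Y)
      have hR''l : ∀ Y, LocStencil (fun κ u => RW'' Y κ u + RB'' 0 Y κ u) (C0 + C0) δ0 := fun Y => locStencil_add (hRW''l Y) (hRB''l Y)
      have hRb : ∀ Y κ u x z a b, |(RW Y κ u + RB 0 Y κ u) x z a b| ≤ C0 + C0 := fun Y κ u x z a b => bdd_of_biLoc (hRl Y κ u) hδ0.le x z a b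
      have hR''b : ∀ Y κ u x z a b, |(RW'' Y κ u + RB'' 0 Y κ u) x z a b| ≤ C0 + C0 := fun Y κ u x z a b => bdd_of_biLoc (hR''l Y κ u) hδ0.le x z a b
      -- the level-0 residual of part C §1 IS the vertex form (§3 `residual_eq_vertexForm₀`)
      have e0 : ∀ y ν y', (1 / 2 : ℝ) • (
              (dM (coDressKBmAt (toSite r) Lc (KInvStep (d := d) Lc 0)) Lc (fun κ u => RW y κ u + RB 0 y κ u) (RM 0 y) ν y'
                - (stepScale d Lc 0 * (Lc : ℝ) ^ (d + 1))⁻¹ • (∑ κ, wsum (fun u => ∑' x₂, ∑ κ₂,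
                  comp (coDressKBmAt (toSite r) Lc (KInvStep (d := d) Lc 0))
                    (dM (coDressKBmAt (toSite r) Lc (KInvStep (d := d) Lc 0)) Lc
                      (SpureRecAt d Lc (toSite r) ((Lc : ℝ) ^ (d + 1)) (-((Lc : ℝ) ^ (d + 1) * (1 / 2) * (Lc : ℝ) ^ (d + 1))) cΛ 0)
                      (M1At d Lc (toSite r) cΛ 0) ν y') u x₂ (Sum.inl κ) (Sum.inl κ₂) * gaugeWt Lc y κ₂ x₂)
                  (SpureRecAt d Lc (toSite r) ((Lc : ℝ) ^ (d + 1)) (-((Lc : ℝ) ^ (d + 1) * (1 / 2) * (Lc : ℝ) ^ (d + 1))) cΛ 0 κ)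
                + ∑ ρ', cwsum Lc (fun w => ∑' x₂, ∑ κ₂,
                  comp (coDressKBmAt (toSite r) Lc (KInvStep (d := d) Lc 0))
                    (dM (coDressKBmAt (toSite r) Lc (KInvStep (d := d) Lc 0)) Lc
                      (SpureRecAt d Lc (toSite r) ((Lc : ℝ) ^ (d + 1)) (-((Lc : ℝ) ^ (d + 1) * (1 / 2) * (Lc : ℝ) ^ (d + 1))) cΛ 0)
                      (M1At d Lc (toSite r) cΛ 0) ν y') ((Lc : ℤ) • w) x₂ (Sum.inr ρ') (Sum.inl κ₂) * gaugeWt Lc y κ₂ x₂)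
                  (M1At d Lc (toSite r) cΛ 0 ρ')))
              + (dM (coDressKBmAt (toSite r) Lc (KInvStep (d := d) Lc 0)) Lc (fun κ u => RW'' y κ u + RB'' 0 y κ u) (RM 0 y) ν y'
                + dM (conjV (coDressKBmAt (toSite r) Lc (KInvStep (d := d) Lc 0))
                    (diagK (((1 : ℝ) / 2) • ∑ v ∈ box (d + 1) Lc, legInd (toSite r) ((Lc : ℤ) • y + toSite v)))) Lc
                  (SpureRecAt d Lc (toSite r) ((Lc : ℝ) ^ (d + 1)) (-((Lc : ℝ) ^ (d + 1) * (1 / 2) * (Lc : ℝ) ^ (d + 1))) cΛ 0)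
                  (M1At d Lc (toSite r) cΛ 0) ν y')) =
            vertexOfK (coDressKBmAt (toSite r) Lc (KInvStep (d := d) Lc 0)) Lc (Φ 0 y) ν y' + Ψf 0 y ν y' := fun y ν y' =>
        residual_eq_vertexForm₀ hK0 Lc (hRb y) (hR''b y) (RM 0 y) _ _ ν y'
      refine ⟨⟨|(1 / 2 : ℝ)| * ((C0 + C0) + (C0 + C0)), δ0, hδ0, fun y => ?_⟩, ?_, fun y ν y' => ?_⟩
      · rw [hΦ0]
        exact locStencil_smul (1 / 2 : ℝ) (locStencil_add (hRl y) (hR''l y))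
      · obtain ⟨C, δ, hδ, h⟩ := exists_vertexFamily_residual_wall hLc hr cΛ 0 (R := fun Y κ u => RW Y κ u + RB 0 Y κ u)
          (R'' := fun Y κ u => RW'' Y κ u + RB'' 0 Y κ u) (RM := RM 0) hδ0 hRl hδ0 hR''l hδ0 hRMl
        refine ⟨C, δ, hδ, fun y => ?_⟩
        have efun := funext fun ν => funext fun y' => e0 y ν y'
        rw [← efun]
        exact h y
      · rw [← e0 y ν y']
        exact divW_WrecAt_zero_of_letters hLc hr cΛ cE₂ cB T hB hmix
          (fun Y κ u x z a b => bdd_of_biLoc (hRWl Y κ u) hδ0.le x z a b) (fun Y κ u x z a b => bdd_of_biLoc (hRW''l Y κ u) hδ0.le x z a b)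
          (fun Y κ u x z a b => bdd_of_biLoc (hRBl Y κ u) hδ0.le x z a b) (fun Y κ u x z a b => bdd_of_biLoc (hRB''l Y κ u) hδ0.le x z a b)
          (fun y ρ' w x z a b => bdd_of_biLoc (hRMl y ρ' w) hδ0.le x z a b) hWil hWil'' hBord0 hBord0'' (hM₂ 0) y ν y'
    | succ j ih =>
      obtain ⟨⟨CΦ, δΦ, hδΦ, hΦl⟩, ⟨CN, δN, hδN, hNl⟩, hlaw⟩ := ih
      obtain ⟨CL, δL, hδL, hRBl, hRB''l, hRMl⟩ := hclsS j
      obtain ⟨δ0, CK0, hδ0, hCK0, hK0⟩ := decays_coDressKBmAt_KInvStep (d := d) hr j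
      have hK1 := decays_coDressKBmAt_KInvStep (d := d) hr (j + 1)
      -- the level-`j` residual in vertex form, its localisation and the bound of its transported sandwich
      have h𝒩 : ∀ y ν y', Loc (vertexOfK (coDressKBmAt (toSite r) Lc (KInvStep (d := d) Lc j)) Lc (Φ j y) ν y' + Ψf j y ν y') :=
        fun y ν y' => ⟨_, _, _, δN, hδN, hNl y ν y'⟩
      obtain ⟨B𝒩, h𝒩b⟩ := exists_bound_transport_wall hLc hr j hδN hNl
      have hRBb : ∀ Y κ u x z a b, |RB (j + 1) Y κ u x z a b| ≤ CL := fun Y κ u x z a b => bdd_of_biLoc (hRBl Y κ u) hδL.le x z a b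
      have hRB''b : ∀ Y κ u x z a b, |RB'' (j + 1) Y κ u x z a b| ≤ CL := fun Y κ u x z a b => bdd_of_biLoc (hRB''l Y κ u) hδL.le x z a b
      have hRMb : ∀ y ρ' w x z a b, |RM (j + 1) y ρ' w x z a b| ≤ CL := fun y ρ' w x z a b => bdd_of_biLoc (hRMl y ρ' w) hδL.le x z a b
      -- bounds on `Φ j` and `Ψf j` (side conditions of the linear algebra only)
      have hΦb : ∀ y κ u x z a b, |Φ j y κ u x z a b| ≤ CΦ := fun y κ u x z a b => bdd_of_biLoc (hΦl y κ u) hδΦ.le x z a b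
      have hΨb : ∀ y ν y' x z a b, |Ψf j y ν y' x z a b| ≤ CN + ((d + 1 : ℕ) : ℝ) * (CK0 * ExpKernelCalculus.Zl (d + 1) δ0 * CΦ) := by
        intro y ν y' x z a b
        have h1 : |(vertexOfK (coDressKBmAt (toSite r) Lc (KInvStep (d := d) Lc j)) Lc (Φ j y) ν y' + Ψf j y ν y') x z a b| ≤ CN :=
          bdd_of_biLoc (hNl y ν y') hδN.le x z a b
        have h2 := Lin4Additive.abs_vertexOfK_le hK0 hδ0 Lc (hΦb y) ν y' x z a b
        have h3 := abs_add_le (-(vertexOfK (coDressKBmAt (toSite r) Lc (KInvStep (d := d) Lc j)) Lc (Φ j y) ν y' x z a b))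
          ((vertexOfK (coDressKBmAt (toSite r) Lc (KInvStep (d := d) Lc j)) Lc (Φ j y) ν y' + Ψf j y ν y') x z a b)
        rw [abs_neg] at h3
        have e : Ψf j y ν y' x z a b = -(vertexOfK (coDressKBmAt (toSite r) Lc (KInvStep (d := d) Lc j)) Lc (Φ j y) ν y' x z a b)
            + (vertexOfK (coDressKBmAt (toSite r) Lc (KInvStep (d := d) Lc j)) Lc (Φ j y) ν y' + Ψf j y ν y') x z a b := by
          simp only [Pi.add_apply]; ring
        rw [e]
        linarith
      -- the two transported remainders of level j+1 and their classes (one common rate)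
      obtain ⟨CR, δR, hδR, hRl⟩ := exists_locStencil_transport_wall hLc hr j
        (-((stepScale d Lc (j + 1) * (Lc : ℝ) ^ (d + 1))⁻¹ * (cE₂ * wV4 d Lc (j + 1)))) hδN hNl hδL hRBl
      obtain ⟨CR'', δR'', hδR'', hR''l⟩ := exists_locStencil_transport_wall hLc hr j
        (-((stepScale d Lc (j + 1) * (Lc : ℝ) ^ (d + 1))⁻¹ * (cE₂ * wV4 d Lc (j + 1)))) hδN hNl hδL hRB''l
      -- THE NEW TABLE IS HALF THE SUM OF THE TWO TRANSPORTED REMAINDERS (§2 `transport_vertexForm` + the lock)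
      have eT : ∀ Y κ' u', Φ (j + 1) Y κ' u' = (1 / 2 : ℝ) • (
          ((-((stepScale d Lc (j + 1) * (Lc : ℝ) ^ (d + 1))⁻¹ * (cE₂ * wV4 d Lc (j + 1)))) •
              ∑ v ∈ box (d + 1) Lc, mmRead Lc (comp (comp (coDressKBmAt (toSite r) Lc (KInvStep (d := d) Lc j))
                ((fun y ν y' => vertexOfK (coDressKBmAt (toSite r) Lc (KInvStep (d := d) Lc j)) Lc (Φ j y) ν y' + Ψf j y ν y') ((Lc : ℤ) • Y + toSite v) κ' u')) (coDressKBmAt (toSite r) Lc (KInvStep (d := d) Lc j)))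
            + RB (j + 1) Y κ' u')
          + ((-((stepScale d Lc (j + 1) * (Lc : ℝ) ^ (d + 1))⁻¹ * (cE₂ * wV4 d Lc (j + 1)))) •
              ∑ v ∈ box (d + 1) Lc, mmRead Lc (comp (comp (coDressKBmAt (toSite r) Lc (KInvStep (d := d) Lc j))
                ((fun y ν y' => vertexOfK (coDressKBmAt (toSite r) Lc (KInvStep (d := d) Lc j)) Lc (Φ j y) ν y' + Ψf j y ν y') ((Lc : ℤ) • Y + toSite v) κ' u')) (coDressKBmAt (toSite r) Lc (KInvStep (d := d) Lc j)))
            + RB'' (j + 1) Y κ' u')) := by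
        intro Y κ' u'
        rw [transport_vertexForm hK0 hδ0 Lc (𝒩 := fun y ν y' => vertexOfK (coDressKBmAt (toSite r) Lc (KInvStep (d := d) Lc j)) Lc (Φ j y) ν y' + Ψf j y ν y')
          hΦb hΨb (fun _ _ _ => rfl) _ _ Y κ' u', neg_neg, lock_cancel (lock_succ_of_pin (d := d) hLc hcE₂ j), hΦS]
        funext x z a b
        simp only [ΦS, Pi.add_apply, Pi.smul_apply, smul_eq_mul]
        ring
      -- the level-(j+1) law: ORIGINAL shape (part C §2) and VERTEX shape (`divW_WrecAt_succ_vertexForm`)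
      have lawO := divW_WrecAt_succ_of_kernelLaw hLc hr cΛ cB hcE₂ T hB hmix j h𝒩 hlaw h𝒩b h𝒩b hRBb hRB''b (hBordS j) (hBordS'' j)
        hRMb (hM₂ (j + 1))
      have lawV := divW_WrecAt_succ_vertexForm hLc hr cΛ cB hcE₂ T hB hmix j h𝒩 hlaw h𝒩b h𝒩b hRBb hRB''b (hBordS j) (hBordS'' j)
        hRMb (hM₂ (j + 1)) hΦb hΨb (fun _ _ _ => rfl)
      refine ⟨⟨|(1 / 2 : ℝ)| * (CR + CR''), min δR δR'', lt_min hδR hδR'', fun Y κ' u' => ?_⟩, ?_, fun y ν y' => ?_⟩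
      · rw [eT Y κ' u']
        exact (locStencil_smul (1 / 2 : ℝ) (locStencil_add (locStencil_mono (hRl Y) ((hRl Y 0 0).nonneg (Sum.inl 0)) (min_le_left _ _))
          (locStencil_mono (hR''l Y) ((hR''l Y 0 0).nonneg (Sum.inl 0)) (min_le_right _ _)))) κ' u'
      · obtain ⟨C, δ, hδ, h⟩ := exists_vertexFamily_residual_wall hLc hr cΛ (j + 1) hδR hRl hδR'' hR''l hδL hRMl
        refine ⟨C, δ, hδ, fun y ν y' => ?_⟩
        have e1 : vertexOfK (coDressKBmAt (toSite r) Lc (KInvStep (d := d) Lc (j + 1))) Lc (Φ (j + 1) y) ν y' + Ψf (j + 1) y ν y' = _ :=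
          add_left_cancel ((lawV y ν y').symm.trans (lawO y ν y'))
        show ExpKernelCalculus.BiLoc (vertexOfK (coDressKBmAt (toSite r) Lc (KInvStep (d := d) Lc (j + 1))) Lc (Φ (j + 1) y) ν y' + Ψf (j + 1) y ν y')
          ((Lc : ℤ) • y') ((Lc : ℤ) • y') C δ
        rw [e1]
        exact h y ν y'
      · exact lawV y ν y'
  exact ⟨Φ, Ψf, fun j y ν y' => rfl, hΦ0, fun j => rfl, fun j => (key j).1, fun j => (key j).2.1, fun j => (key j).2.2⟩

end Summit.QuantumFields.BalabanUV.Beta.GAN24.WardResidualSRecursionAll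

end
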